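import Summits.QuantumFields.YangMills.Theorems.F4SubCurvatureDoorForwardConeLukacsPringsheim
import Mathlib
import HarnessLib

/-!
# Vivanti–Pringsheim for cosine transforms, holomorphic-disc form with the `2M` bound (S1 programme, crux ⟨stmt-QuantumFields-23125⟩)

Free-hands helper of width seat `ym-line-sfw-p2-w3` (g37, cell `ym-idea-1`): the one-dimensional analytic core of the owner's rung
«PRINGSHEIM IDENTIFICATION» (`ForwardConeRungs.PringsheimIdentification`, `Cruxes/RationalToGeneral/Lines/forward_cone_rungs.lean`), in the form
in which the rung uses it:

* `hasFPowerSeriesOnBall_ofScalars` — a real power series `Σ aₙ yⁿ → φ(y)` on `|y| < R` is a `HasFPowerSeriesOnBall` for `ofScalars ℝ a`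
  (radius from boundedness of the terms at every smaller radius);
* `expMoment_le_of_differentiableOn` — if `g` is holomorphic on the disc `|w| < ρ`, bounded by `M` there, and `g(s) = ∫ cos(sq) dm` for real
  `|s| < ρ` (`m` a finite positive measure on `ℝ`), then for every `0 < δ < ρ`: `e^{δ|q|}` is `m`-integrable and `∫ e^{δ|q|} dm ≤ 2M`.
  PROOF: Cauchy power series of `g` on `|w| ≤ R` (`δ < R < ρ`), real parts of its coefficients give a real power series for `φ`
  (previous bullet), so `∫ cosh(δq) dm = Σ_k (−1)^k Re(c_{2k}) δ^{2k}` by `expMoment_of_hasFPowerSeriesOnBall`; and the EVEN part of the complex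
  series is `Σ_k (−1)^k c_{2k} δ^{2k} = (g(iδ) + g(−iδ))/2` (odd terms cancel — no reality of the `cₙ` is needed), of norm `≤ M`; finally
  `e^{δ|q|} ≤ 2cosh(δq)`.

HONEST LABEL: classical analysis toward OPEN rungs; S1, ⟨23125⟩, ⟨23035⟩ and R2d stay OPEN; the Yang–Mills mass gap is NOT proved.
-/

set_option autoImplicit false

noncomputable section

namespace Summit.QuantumFields.YangMills.Theorems.F4SubCurvatureDoorForwardConeLukacs

open Finset MeasureTheory Filter
open scoped BigOperators Real Topology ENNReal

/-! ## Real power series from termwise convergence -/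

/-- A real power series `Σ aₙ yⁿ` converging to `φ(y)` for every `|y| < R` (`0 < R`) presents `φ` as `HasFPowerSeriesOnBall` for
`FormalMultilinearSeries.ofScalars ℝ a` on the ball of radius `R`. -/
theorem hasFPowerSeriesOnBall_ofScalars {φ : ℝ → ℝ} {a : ℕ → ℝ} {R : ℝ} (hR : 0 < R)
    (hsum : ∀ y : ℝ, |y| < R → HasSum (fun n => a n * y ^ n) (φ y)) :
    HasFPowerSeriesOnBall φ (FormalMultilinearSeries.ofScalars ℝ a) 0 (ENNReal.ofReal R) where
  r_le := by
    refine ENNReal.le_of_forall_nnreal_lt fun r hr => ?_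
    have hrR : (r : ℝ) < R := by
      have := (ENNReal.lt_ofReal_iff_toReal_lt ENNReal.coe_ne_top).1 hr
      simpa using this
    have hs := (hsum r (by rw [NNReal.abs_eq]; exact hrR)).summable
    have ht := (hs.tendsto_atTop_zero).abs
    rw [abs_zero] at ht
    obtain ⟨C, hC⟩ := ht.bddAbove_range
    refine FormalMultilinearSeries.le_radius_of_bound _ C fun n => ?_
    rw [FormalMultilinearSeries.ofScalars_norm, Real.norm_eq_abs, ← abs_of_nonneg (pow_nonneg (NNReal.coe_nonneg r) n),
      ← abs_mul]
    exact hC ⟨n, rfl⟩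
  r_pos := by simpa using hR
  hasSum := by
    intro y hy
    have hy' : |y| < R := by
      rw [Metric.mem_eball, edist_zero_right, ← ofReal_norm, Real.norm_eq_abs] at hy
      exact (ENNReal.ofReal_lt_ofReal_iff hR).1 hy
    rw [zero_add]
    refine (hsum y hy').congr_fun fun n => ?_
    rw [FormalMultilinearSeries.ofScalars_apply_eq, smul_eq_mul, mul_comm]

/-! ## The holomorphic-disc form with the `2M` bound -/

/-- `e^{δ|q|} ≤ 2cosh(δq)` for `δ > 0`. -/
theorem exp_mul_abs_le_two_mul_cosh {δ : ℝ} (hδ : 0 < δ) (q : ℝ) : Real.exp (δ * |q|) ≤ 2 * Real.cosh (δ * q) := by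
  have h1 : Real.cosh (δ * q) = Real.cosh (δ * |q|) := by
    rw [← Real.cosh_abs (δ * q), abs_mul, abs_of_pos hδ]
  rw [h1, Real.cosh_eq]
  have := Real.exp_pos (-(δ * |q|))
  linarith

/-- `cosh(δq) ≤ e^{δ|q|}` for `δ ≥ 0`. -/
theorem cosh_le_exp_mul_abs {δ : ℝ} (hδ : 0 ≤ δ) (q : ℝ) : Real.cosh (δ * q) ≤ Real.exp (δ * |q|) := by
  rw [Real.cosh_eq]
  have h1 : Real.exp (δ * q) ≤ Real.exp (δ * |q|) := Real.exp_le_exp.2 (mul_le_mul_of_nonneg_left (le_abs_self q) hδ)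
  have h2 : Real.exp (-(δ * q)) ≤ Real.exp (δ * |q|) := Real.exp_le_exp.2 (by
    rw [← mul_neg]; exact mul_le_mul_of_nonneg_left (neg_le_abs q) hδ)
  linarith

/-- **Vivanti–Pringsheim, disc form.**  Let `m` be a finite positive measure on `ℝ` and `g : ℂ → ℂ` holomorphic on the disc `|w| < ρ`, bounded by
`M` there, with `g(s) = ∫ cos(sq) dm` for real `|s| < ρ`.  Then for every `0 < δ < ρ`: `q ↦ e^{δ|q|}` is `m`-integrable and
`∫ e^{δ|q|} dm ≤ 2M`. -/
theorem expMoment_le_of_differentiableOn (m : Measure ℝ) [IsFiniteMeasure m] (g : ℂ → ℂ) {ρ M : ℝ}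
    (hg : DifferentiableOn ℂ g (Metric.ball 0 ρ)) (hM : ∀ w ∈ Metric.ball (0 : ℂ) ρ, ‖g w‖ ≤ M)
    (hφ : ∀ s : ℝ, |s| < ρ → g s = ((∫ q, Real.cos (s * q) ∂m : ℝ) : ℂ)) {δ : ℝ} (hδ : 0 < δ) (hδρ : δ < ρ) :
    Integrable (fun q : ℝ => Real.exp (δ * |q|)) m ∧ ∫ q, Real.exp (δ * |q|) ∂m ≤ 2 * M := by
  -- an intermediate radius `δ < R < ρ`
  set R : ℝ := (δ + ρ) / 2 with hR_def
  have hδR : δ < R := by rw [hR_def]; linarith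
  have hRρ : R < ρ := by rw [hR_def]; linarith
  have hR : 0 < R := hδ.trans hδR
  set RN : NNReal := ⟨R, hR.le⟩ with hRN_def
  have hRN : (RN : ℝ) = R := rfl
  -- the Cauchy power series of `g` on `|w| ≤ R`
  have hcps : HasFPowerSeriesOnBall g (cauchyPowerSeries g 0 RN) 0 RN := by
    refine DifferentiableOn.hasFPowerSeriesOnBall (hg.mono ?_) (by exact_mod_cast hR)
    rw [hRN]
    exact Metric.closedBall_subset_ball hRρ
  set c : ℕ → ℂ := fun n => (cauchyPowerSeries g 0 RN).coeff n with hc_def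
  have hsumC : ∀ z : ℂ, ‖z‖ < R → HasSum (fun n => z ^ n * c n) (g z) := by
    intro z hz
    have hz' : z ∈ Metric.eball (0 : ℂ) RN := by
      rw [Metric.mem_eball, edist_zero_right, ← ofReal_norm, ENNReal.coe_nnreal_eq, hRN]
      exact (ENNReal.ofReal_lt_ofReal_iff hR).2 hz
    have hs := hcps.hasSum hz'
    rw [zero_add] at hs
    refine hs.congr_fun fun n => ?_
    rw [FormalMultilinearSeries.apply_eq_pow_smul_coeff, smul_eq_mul]
  -- the real power series of `φ(s) = ∫ cos(sq) dm`
  set φ : ℝ → ℝ := fun s => ∫ q, Real.cos (s * q) ∂m with hφ_def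
  set a : ℕ → ℝ := fun n => (c n).re with ha_def
  have hsumR : ∀ y : ℝ, |y| < R → HasSum (fun n => a n * y ^ n) (φ y) := by
    intro y hy
    have h1 := (hsumC (y : ℂ) (by rwa [Complex.norm_real, Real.norm_eq_abs])).mapL Complex.reCLM
    rw [hφ y (hy.trans hRρ), Complex.reCLM_apply, Complex.ofReal_re] at h1
    refine h1.congr_fun fun n => ?_
    rw [Complex.reCLM_apply, ← Complex.ofReal_pow, Complex.re_ofReal_mul, ha_def, mul_comm]
  have hps : HasFPowerSeriesOnBall φ (FormalMultilinearSeries.ofScalars ℝ a) 0 (ENNReal.ofReal R) :=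
    hasFPowerSeriesOnBall_ofScalars hR hsumR
  -- exponential moment and the `cosh`-series identity
  have hE := expMoment_of_hasFPowerSeriesOnBall m φ (fun s => rfl) hps hδ ((ENNReal.ofReal_lt_ofReal_iff hR).2 hδR)
  refine ⟨hE.1, ?_⟩
  have hcosh : HasSum (fun k : ℕ => (-1 : ℝ) ^ k * a (2 * k) * δ ^ (2 * k)) (∫ q, Real.cosh (δ * q) ∂m) := by
    refine hE.2.congr_fun fun k => ?_
    rw [FormalMultilinearSeries.coeff_ofScalars]
  -- the even part of the complex series: `Σ_k (−1)^k c_{2k} δ^{2k} = (g(iδ) + g(−iδ))/2`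
  have hnI : ‖(δ : ℂ) * Complex.I‖ < R := by
    rw [norm_mul, Complex.norm_I, mul_one, Complex.norm_real, Real.norm_eq_abs, abs_of_pos hδ]; exact hδR
  have h_plus := hsumC ((δ : ℂ) * Complex.I) hnI
  have h_minus := hsumC (-((δ : ℂ) * Complex.I)) (by rwa [norm_neg])
  have h_add := h_plus.add h_minus
  set f : ℕ → ℂ := fun n => (((δ : ℂ) * Complex.I) ^ n + (-((δ : ℂ) * Complex.I)) ^ n) * c n with hf_def
  have hf_sum : HasSum f (g ((δ : ℂ) * Complex.I) + g (-((δ : ℂ) * Complex.I))) := by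
    refine h_add.congr_fun fun n => ?_
    simp only [hf_def]
    ring
  have hf_odd : ∀ n ∉ Set.range (fun k : ℕ => 2 * k), f n = 0 := by
    intro n hn
    have hodd : Odd n := by
      by_contra h
      obtain ⟨r, hr⟩ := Nat.not_odd_iff_even.1 h
      exact hn ⟨r, by rw [hr]; ring⟩
    simp only [hf_def, hodd.neg_pow, add_neg_cancel, zero_mul]
  have hf_even : HasSum (fun k : ℕ => f (2 * k)) (g ((δ : ℂ) * Complex.I) + g (-((δ : ℂ) * Complex.I))) :=
    (Function.Injective.hasSum_iff (mul_right_injective₀ (two_ne_zero' ℕ)) hf_odd).2 hf_sum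
  have hf_2k : ∀ k : ℕ, f (2 * k) = 2 * ((-1 : ℂ) ^ k * c (2 * k) * (δ : ℂ) ^ (2 * k)) := by
    intro k
    simp only [hf_def]
    rw [neg_pow, pow_mul (-1 : ℂ) 2 k, neg_one_sq, one_pow, one_mul, mul_pow, pow_mul Complex.I 2 k, Complex.I_sq]
    ring
  -- real parts: `Σ_k (−1)^k a_{2k} δ^{2k} = Re(g(iδ) + g(−iδ))/2`
  have hre : HasSum (fun k : ℕ => (-1 : ℝ) ^ k * a (2 * k) * δ ^ (2 * k))
      ((g ((δ : ℂ) * Complex.I) + g (-((δ : ℂ) * Complex.I))).re / 2) := by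
    have h1 := (hf_even.mapL Complex.reCLM).div_const 2
    rw [Complex.reCLM_apply] at h1
    refine h1.congr_fun fun k => ?_
    rw [Complex.reCLM_apply, hf_2k, show (2 : ℂ) * ((-1 : ℂ) ^ k * c (2 * k) * (δ : ℂ) ^ (2 * k)) =
      (((2 * (-1 : ℝ) ^ k * δ ^ (2 * k) : ℝ)) : ℂ) * c (2 * k) by push_cast; ring, Complex.re_ofReal_mul, ha_def]
    ring
  have hval : ∫ q, Real.cosh (δ * q) ∂m = (g ((δ : ℂ) * Complex.I) + g (-((δ : ℂ) * Complex.I))).re / 2 :=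
    hcosh.unique hre
  have hcosh_le : ∫ q, Real.cosh (δ * q) ∂m ≤ M := by
    rw [hval, div_le_iff₀ (by norm_num : (0 : ℝ) < 2)]
    have h1 := Complex.re_le_norm (g ((δ : ℂ) * Complex.I) + g (-((δ : ℂ) * Complex.I)))
    have h2 := norm_add_le (g ((δ : ℂ) * Complex.I)) (g (-((δ : ℂ) * Complex.I)))
    have h3 := hM ((δ : ℂ) * Complex.I) (by rw [Metric.mem_ball, dist_zero_right]; exact hnI.trans hRρ)
    have h4 := hM (-((δ : ℂ) * Complex.I)) (by rw [Metric.mem_ball, dist_zero_right, norm_neg]; exact hnI.trans hRρ)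
    linarith
  -- `∫ e^{δ|q|} ≤ 2 ∫ cosh(δq) ≤ 2M`
  have hcosh_int : Integrable (fun q : ℝ => Real.cosh (δ * q)) m :=
    hE.1.mono' (Continuous.aestronglyMeasurable (by fun_prop))
      (ae_of_all _ fun q => by
        rw [Real.norm_eq_abs, abs_of_pos (Real.cosh_pos _)]
        exact cosh_le_exp_mul_abs hδ.le q)
  calc ∫ q, Real.exp (δ * |q|) ∂m ≤ ∫ q, 2 * Real.cosh (δ * q) ∂m :=
        integral_mono hE.1 (hcosh_int.const_mul 2) fun q => exp_mul_abs_le_two_mul_cosh hδ q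
    _ = 2 * ∫ q, Real.cosh (δ * q) ∂m := integral_const_mul _ _
    _ ≤ 2 * M := by linarith

end Summit.QuantumFields.YangMills.Theorems.F4SubCurvatureDoorForwardConeLukacs

end
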